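import Mathlib
import Literature.Analysis.FluidPDE.VectorCalculus
import Summits.NavierStokesRegularity.NavierStokesRegularity.Theorems.FilamentSkeletonRssClause13RAdjointStraightModel

/-!
# Clause 13-R, route (ii′) item (c), MODEL REDUCTION (integrated form): the adjoint weights `A, B, C` of `…Clause13RAdjointOperator` on a STRAIGHT axis
# (crux `Clause13RNearStraightL`, stmt-NavierStokesRegularity-23612; line `rate_bordered_split`, STUB R `stub_rateRow13RFlat`)

Route `FilamentSkeletonRss`, Variant A1R.  On the straight axis `X u = p + u•d` with a constant core `q` the three adjoint weights of the self pair
(`j = k`, the model of census item (c)) are scalar LIA-type integral operators acting on `φ × d` (pointwise algebra `…Clause13RAdjointStraightModel`):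

* `straight_A_eq` : `A(σ) = (∫ ((‖Xσ − Xu‖² + q)^{3/2})⁻¹ du) • (φ(σ) × d)`;
* `straight_B_eq` : `B(σ) = −∫_S ((‖Xτ − Xσ‖² + q)^{3/2})⁻¹ • (φ(τ) × d) dτ`;
* `straight_C_eq` : `C(σ) = ∫_S (((‖Xτ − Xσ‖² + q)^{3/2})⁻¹ − 3(τ−σ)²‖d‖²((‖Xτ − Xσ‖² + q)^{5/2})⁻¹) • (φ(τ) × d) dτ`;
* `straight_kernel_sq` : on the line `‖Xτ − Xσ‖² = (τ − σ)²‖d‖²`, so all kernels are even functions of `τ − σ`.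

Hence the model adjoint equation of item (c) reads, for a normal weight `φ` on the ball `S` (with `c = Γγ/4π`, slip `w`, swirl `α`):
`c[(∫K₃)•(φ(σ) × d) − ∫_S (2K₃(τ−σ) − 3(τ−σ)²‖d‖²K₅(τ−σ))•(φ(τ) × d) dτ] + ½φ + α e₃ × φ + w′φ + wφ′ = 0` on `S`
(the bracket is the transpose of the Taylor-remainder/LIA operator; its kernel `2K₃ − 3s²K₅ = (2q − s²)/(s² + q)^{5/2}` (for `‖d‖ = 1`) has total mass `∫K₃`
and zero first moment, so constant and affine normal weights are annihilated away from `∂S` — `…Clause13RAffineAnnihilator`).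
Hand `leafhand-ns-filamentskeletonrs-10-g0` (LAND-ONLY); `--supports stmt-NavierStokesRegularity-23612` helper.  HONEST FRAMING: algebra for the MODEL of a
HYPOTHETICAL filament skeleton on the NEGATIVE side of a MODEL blow-up route; STUB R is NOT proved here and nothing in this file bears on Navier–Stokes
regularity or blow-up.
-/

noncomputable section

open MeasureTheory Filter Topology Set
open scoped RealInnerProductSpace InnerProductSpace
open Literature.Analysis.FluidPDE
open Summit.NavierStokesRegularity.NavierStokesRegularity.Theorems.Clause13RAdjointStraightModel

namespace Summit.NavierStokesRegularity.NavierStokesRegularity.Theorems.Clause13RAdjointStraightModelWeights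
set_option linter.dupNamespace false

/-- On the line, `‖Xτ − Xσ‖² = (τ − σ)²‖d‖²` inside the kernels. [folklore] -/
theorem straight_kernel_sq (p d : EuclideanSpace ℝ (Fin 3)) (τ σ q r : ℝ) :
    ((‖(p + τ • d) - (p + σ • d)‖ ^ 2 + q) ^ r)⁻¹ = (((τ - σ) ^ 2 * ‖d‖ ^ 2 + q) ^ r)⁻¹ := by
  rw [norm_line_chord_sq]

/-- **`A` on a straight axis** (tangent `d` substituted for `X′`): `A(σ) = (∫ K₃(σ,u) du) • (φ(σ) × d)`. [folklore] -/
theorem straight_A_eq (p d φσ : EuclideanSpace ℝ (Fin 3)) (σ q : ℝ) :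
    ∫ u : ℝ, ((-3 * ((‖(p + σ • d) - (p + u • d)‖ ^ 2 + q) ^ (5 / 2 : ℝ))⁻¹ * ⟪φσ, cross d ((p + σ • d) - (p + u • d))⟫) • ((p + σ • d) - (p + u • d))
        + ((‖(p + σ • d) - (p + u • d)‖ ^ 2 + q) ^ (3 / 2 : ℝ))⁻¹ • cross φσ d)
      = (∫ u : ℝ, ((‖(p + σ • d) - (p + u • d)‖ ^ 2 + q) ^ (3 / 2 : ℝ))⁻¹) • cross φσ d := by
  rw [← integral_smul_const]
  refine integral_congr_ae (Eventually.of_forall fun u => ?_)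
  exact straight_A_integrand p d φσ σ u _ _

/-- **`B` on a straight axis**: `B(σ) = −∫_S K₃(τ,σ) • (φ(τ) × d) dτ`. [folklore] -/
theorem straight_B_eq (p d : EuclideanSpace ℝ (Fin 3)) (φ : ℝ → EuclideanSpace ℝ (Fin 3)) (S : Set ℝ) (σ q : ℝ) :
    ∫ τ in S, ((3 * ((‖(p + τ • d) - (p + σ • d)‖ ^ 2 + q) ^ (5 / 2 : ℝ))⁻¹ * ⟪φ τ, cross d ((p + τ • d) - (p + σ • d))⟫) • ((p + τ • d) - (p + σ • d))
        - ((‖(p + τ • d) - (p + σ • d)‖ ^ 2 + q) ^ (3 / 2 : ℝ))⁻¹ • cross (φ τ) d)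
      = -∫ τ in S, ((‖(p + τ • d) - (p + σ • d)‖ ^ 2 + q) ^ (3 / 2 : ℝ))⁻¹ • cross (φ τ) d := by
  rw [← integral_neg]
  refine integral_congr_ae (Eventually.of_forall fun τ => ?_)
  exact straight_B_integrand p d (φ τ) τ σ _ _

/-- **`C` on a straight axis** (constant core): `C(σ) = ∫_S (K₃ − 3(τ−σ)²‖d‖²K₅) • (φ(τ) × d) dτ`. [folklore] -/
theorem straight_C_eq (p d : EuclideanSpace ℝ (Fin 3)) (φ : ℝ → EuclideanSpace ℝ (Fin 3)) (S : Set ℝ) (σ q : ℝ) :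
    ∫ τ in S, ((3 * ⟪(p + τ • d) - (p + σ • d), d⟫ * ((‖(p + τ • d) - (p + σ • d)‖ ^ 2 + q) ^ (5 / 2 : ℝ))⁻¹) • cross (φ τ) ((p + σ • d) - (p + τ • d))
        + ((‖(p + τ • d) - (p + σ • d)‖ ^ 2 + q) ^ (3 / 2 : ℝ))⁻¹ • cross (φ τ) d)
      = ∫ τ in S, (((‖(p + τ • d) - (p + σ • d)‖ ^ 2 + q) ^ (3 / 2 : ℝ))⁻¹
          - 3 * (τ - σ) ^ 2 * ‖d‖ ^ 2 * ((‖(p + τ • d) - (p + σ • d)‖ ^ 2 + q) ^ (5 / 2 : ℝ))⁻¹) • cross (φ τ) d := by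
  refine integral_congr_ae (Eventually.of_forall fun τ => ?_)
  exact straight_C_integrand p d (φ τ) τ σ _ _

/-- The combination `B − C` on a straight axis (the nonlocal self weight of the model adjoint operator):
`(B − C)(σ) = −∫_S (2K₃ − 3(τ−σ)²‖d‖²K₅) • (φ(τ) × d) dτ`, given integrability of the two pieces on `S`. [folklore] -/
theorem straight_B_sub_C_eq (p d : EuclideanSpace ℝ (Fin 3)) (φ : ℝ → EuclideanSpace ℝ (Fin 3)) (S : Set ℝ) (σ q : ℝ)
    (h3 : IntegrableOn (fun τ => ((‖(p + τ • d) - (p + σ • d)‖ ^ 2 + q) ^ (3 / 2 : ℝ))⁻¹ • cross (φ τ) d) S)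
    (h5 : IntegrableOn (fun τ => (3 * (τ - σ) ^ 2 * ‖d‖ ^ 2 * ((‖(p + τ • d) - (p + σ • d)‖ ^ 2 + q) ^ (5 / 2 : ℝ))⁻¹) • cross (φ τ) d) S) :
    (∫ τ in S, ((3 * ((‖(p + τ • d) - (p + σ • d)‖ ^ 2 + q) ^ (5 / 2 : ℝ))⁻¹ * ⟪φ τ, cross d ((p + τ • d) - (p + σ • d))⟫) • ((p + τ • d) - (p + σ • d))
        - ((‖(p + τ • d) - (p + σ • d)‖ ^ 2 + q) ^ (3 / 2 : ℝ))⁻¹ • cross (φ τ) d))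
      - (∫ τ in S, ((3 * ⟪(p + τ • d) - (p + σ • d), d⟫ * ((‖(p + τ • d) - (p + σ • d)‖ ^ 2 + q) ^ (5 / 2 : ℝ))⁻¹) • cross (φ τ) ((p + σ • d) - (p + τ • d))
        + ((‖(p + τ • d) - (p + σ • d)‖ ^ 2 + q) ^ (3 / 2 : ℝ))⁻¹ • cross (φ τ) d))
      = -∫ τ in S, (2 * ((‖(p + τ • d) - (p + σ • d)‖ ^ 2 + q) ^ (3 / 2 : ℝ))⁻¹
          - 3 * (τ - σ) ^ 2 * ‖d‖ ^ 2 * ((‖(p + τ • d) - (p + σ • d)‖ ^ 2 + q) ^ (5 / 2 : ℝ))⁻¹) • cross (φ τ) d := by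
  rw [straight_B_eq, straight_C_eq]
  have hsplit : ∫ τ in S, (((‖(p + τ • d) - (p + σ • d)‖ ^ 2 + q) ^ (3 / 2 : ℝ))⁻¹
          - 3 * (τ - σ) ^ 2 * ‖d‖ ^ 2 * ((‖(p + τ • d) - (p + σ • d)‖ ^ 2 + q) ^ (5 / 2 : ℝ))⁻¹) • cross (φ τ) d
      = (∫ τ in S, ((‖(p + τ • d) - (p + σ • d)‖ ^ 2 + q) ^ (3 / 2 : ℝ))⁻¹ • cross (φ τ) d)
        - ∫ τ in S, (3 * (τ - σ) ^ 2 * ‖d‖ ^ 2 * ((‖(p + τ • d) - (p + σ • d)‖ ^ 2 + q) ^ (5 / 2 : ℝ))⁻¹) • cross (φ τ) d := by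
    rw [← integral_sub h3 h5]
    refine integral_congr_ae (Eventually.of_forall fun τ => ?_)
    simp only [sub_smul]
  have hsplit2 : ∫ τ in S, (2 * ((‖(p + τ • d) - (p + σ • d)‖ ^ 2 + q) ^ (3 / 2 : ℝ))⁻¹
          - 3 * (τ - σ) ^ 2 * ‖d‖ ^ 2 * ((‖(p + τ • d) - (p + σ • d)‖ ^ 2 + q) ^ (5 / 2 : ℝ))⁻¹) • cross (φ τ) d
      = (2 : ℝ) • (∫ τ in S, ((‖(p + τ • d) - (p + σ • d)‖ ^ 2 + q) ^ (3 / 2 : ℝ))⁻¹ • cross (φ τ) d)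
        - ∫ τ in S, (3 * (τ - σ) ^ 2 * ‖d‖ ^ 2 * ((‖(p + τ • d) - (p + σ • d)‖ ^ 2 + q) ^ (5 / 2 : ℝ))⁻¹) • cross (φ τ) d := by
    have h3' : IntegrableOn (fun τ => (2 : ℝ) • (((‖(p + τ • d) - (p + σ • d)‖ ^ 2 + q) ^ (3 / 2 : ℝ))⁻¹ • cross (φ τ) d)) S :=
      h3.smul (2 : ℝ)
    rw [← integral_smul (2:ℝ), ← integral_sub h3' h5]
    refine integral_congr_ae (Eventually.of_forall fun τ => ?_)
    simp only [sub_smul, smul_smul]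
  rw [hsplit, hsplit2, two_smul]
  abel

end Summit.NavierStokesRegularity.NavierStokesRegularity.Theorems.Clause13RAdjointStraightModelWeights

end
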